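import Mathlib

/-!
# Crux `RtdLocal` (stmt-ResolutionOfSingularities-18840), line `Sketch` — stub `stub_collapse`

COLLAPSE a strictly dominated block (DOWN move; typed Monreal Lemma 3.21 + Prop 4.2).

Write `H := k⟦t^ℚ⟧ = HahnSeries ℚ k`, `v := orderTop`. For arcs `a : ι` with coordinates
`c a : J → H` and an extra block `d a : J' → H` that is strictly dominated by `c` on distinct arcs
(`hdom`), a typed straightener `(W', φ')` for the joined family `(c, d)` projects to one for `c`
of the same rank, provided there is at least one arc:

* key step (`collapse_key`): every `u ∈ W'` has zero `J'`-block. Test the translation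
  `w' := t • C u` (positive, and in the `H`-span of `C '' W'`) against clause (3) at an arc `a₀`:
  it is realised by an arc `b`, `φ' b = φ' a₀ + w'`. If `b = a₀` then `w' = 0`; otherwise clause
  (1) for `(b, a₀)` pins the dominant order `μ = v (w' j) = 1`, forces `v (Δ i) ≥ 1` for every
  coordinate difference `Δ i`, and domination then gives `v (Δ (inr i')) > 1`, whence
  `v (w' (inr i')) > 1`, i.e. `u (inr i') = 0` (`collapse_core` is the ultrametric bookkeeping);
* witness: `W := W'.map (· ∘ Sum.inl)` (same `finrank`, the projection being injective on `W'` by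
  the key step) and `φ a j := φ' a (inl j)`; clause (1) uses `hdom` to replace a dominant index in
  the `J'`-block by one in the `J`-block, clause (3) extends a translation `w` by zero.
-/

set_option linter.dupNamespace false

namespace Summit.ResolutionOfSingularities.ResolutionOfSingularities.Theorems

section Helpers

variable {k : Type} [Field k]

/-- `v (t • C x) ≥ 1`. -/
theorem collapse_one_le_orderTop_single_one (x : k) :
    (1 : WithTop ℚ) ≤ (HahnSeries.single (1 : ℚ) x).orderTop :=
  WithTop.coe_one.symm.trans_le HahnSeries.orderTop_single_le

/-- `v (t • C x) > 0`. -/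
theorem collapse_orderTop_single_one_pos (x : k) :
    (0 : WithTop ℚ) < (HahnSeries.single (1 : ℚ) x).orderTop :=
  lt_of_lt_of_le (by exact_mod_cast (one_pos : (0 : ℚ) < 1))
    (collapse_one_le_orderTop_single_one x)

/-- `v (t • C x) ≠ ⊤` forces `v (t • C x) = 1`. -/
theorem collapse_orderTop_single_one_of_ne_top {x : k}
    (h : (HahnSeries.single (1 : ℚ) x).orderTop ≠ ⊤) :
    (HahnSeries.single (1 : ℚ) x).orderTop = 1 := by
  have hx : x ≠ 0 := fun hx => h (by rw [hx, map_zero, HahnSeries.orderTop_zero])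
  rw [HahnSeries.orderTop_single hx, WithTop.coe_one]

/-- Ultrametric bookkeeping of the collapse test: if the straightened errors `w i - Δ i` all have
order `> v (Δ j)`, every `v (w i)` is `≥ ν`, and every finite `v (w i)` equals `ν`, then every
`v (Δ i)` is `≥ ν`, and `v (Δ i) > ν` forces `v (w i) > ν`. -/
theorem collapse_core {I : Type} {Δ w : I → HahnSeries ℚ k} {ν : WithTop ℚ} {j : I}
    (herr : ∀ i, (Δ j).orderTop < (w i - Δ i).orderTop)
    (hle : ∀ i, ν ≤ (w i).orderTop)
    (hdich : ∀ i, (w i).orderTop ≠ ⊤ → (w i).orderTop = ν) :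
    (∀ i, ν ≤ (Δ i).orderTop) ∧ ∀ i, ν < (Δ i).orderTop → ν < (w i).orderTop := by
  have hwj : (w j).orderTop = (Δ j).orderTop := by
    have h := HahnSeries.orderTop_add_eq_left (herr j)
    rwa [add_sub_cancel] at h
  have hμ : (Δ j).orderTop = ν := by
    rw [← hwj]
    exact hdich j (hwj.trans_ne (herr j).ne_top)
  have herr' : ∀ i, ν < (w i - Δ i).orderTop := fun i => hμ.symm.trans_lt (herr i)
  refine ⟨fun i => ?_, fun i hi => ?_⟩
  · have h := HahnSeries.min_orderTop_le_orderTop_sub (x := w i) (y := w i - Δ i)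
    rw [sub_sub_cancel] at h
    exact (le_min (hle i) (herr' i).le).trans h
  · have h := HahnSeries.min_orderTop_le_orderTop_add (x := Δ i) (y := w i - Δ i)
    rw [add_sub_cancel] at h
    exact (lt_min hi (herr' i)).trans_le h

/-- **Key step.** Under strict domination of the `J'`-block and clauses (1), (3) of a typed
straightener for the joined family, every `u ∈ W'` has zero `J'`-block. -/
theorem collapse_key {ι J J' : Type} {c : ι → J → HahnSeries ℚ k} {d : ι → J' → HahnSeries ℚ k}
    (hdom : ∀ a b, a ≠ b → ∃ j, ∀ i, (c a j - c b j).orderTop < (d a i - d b i).orderTop)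
    {W' : Submodule k (J ⊕ J' → k)} {φ' : ι → J ⊕ J' → HahnSeries ℚ k}
    (h1 : ∀ a b, a ≠ b → ∃ j, ∀ i,
      (Sum.elim (c a) (d a) j - Sum.elim (c b) (d b) j).orderTop <
        ((φ' a i - φ' b i) - (Sum.elim (c a) (d a) i - Sum.elim (c b) (d b) i)).orderTop)
    (h3 : ∀ a (w : J ⊕ J' → HahnSeries ℚ k), (∀ i, 0 < (w i).orderTop) →
      w ∈ Submodule.span (HahnSeries ℚ k)
        ((fun u : J ⊕ J' → k => fun i => HahnSeries.C (u i)) '' (W' : Set (J ⊕ J' → k))) →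
      ∃ b, φ' b = φ' a + w)
    (a₀ : ι) {u : J ⊕ J' → k} (hu : u ∈ W') (i' : J') : u (Sum.inr i') = 0 := by
  -- the test translation `w' := t • C u`
  have hpos : ∀ i, (0 : WithTop ℚ) < (HahnSeries.single (1 : ℚ) (u i)).orderTop := fun i =>
    collapse_orderTop_single_one_pos (u i)
  have hmem : (fun i => HahnSeries.single (1 : ℚ) (u i)) ∈ Submodule.span (HahnSeries ℚ k)
      ((fun u : J ⊕ J' → k => fun i => HahnSeries.C (u i)) '' (W' : Set (J ⊕ J' → k))) := by
    have he : (fun i => HahnSeries.single (1 : ℚ) (u i)) =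
        (HahnSeries.single (1 : ℚ) (1 : k)) • (fun i => HahnSeries.C (u i)) := by
      funext i
      rw [Pi.smul_apply, smul_eq_mul, HahnSeries.C_apply, HahnSeries.single_mul_single, add_zero,
        one_mul]
    rw [he]
    exact Submodule.smul_mem _ _ (Submodule.subset_span ⟨u, hu, rfl⟩)
  obtain ⟨b, hb⟩ := h3 a₀ _ hpos hmem
  by_cases hba : b = a₀
  · -- the trivial realisation forces `w' = 0`
    subst hba
    have h0 : (fun i => HahnSeries.single (1 : ℚ) (u i)) = 0 := left_eq_add.mp hb
    have h0i : HahnSeries.single (1 : ℚ) (u (Sum.inr i')) = 0 := congr_fun h0 (Sum.inr i')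
    exact HahnSeries.single_eq_zero_iff.mp h0i
  · -- a nontrivial realisation: clause (1) for `(b, a₀)` and domination
    obtain ⟨j, hj⟩ := h1 b a₀ hba
    simp only [hb, Pi.add_apply, add_sub_cancel_left] at hj
    have hle : ∀ i, (1 : WithTop ℚ) ≤ (HahnSeries.single (1 : ℚ) (u i)).orderTop := fun i =>
      collapse_one_le_orderTop_single_one (u i)
    have hdich : ∀ i, (HahnSeries.single (1 : ℚ) (u i)).orderTop ≠ ⊤ →
        (HahnSeries.single (1 : ℚ) (u i)).orderTop = 1 := fun i hi =>
      collapse_orderTop_single_one_of_ne_top hi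
    obtain ⟨hge, hgt⟩ := collapse_core (ν := 1)
      (Δ := fun i => Sum.elim (c b) (d b) i - Sum.elim (c a₀) (d a₀) i)
      (w := fun i => HahnSeries.single (1 : ℚ) (u i)) (j := j) hj hle hdich
    obtain ⟨j₂, hj₂⟩ := hdom b a₀ hba
    have hlt : (1 : WithTop ℚ) < (HahnSeries.single (1 : ℚ) (u (Sum.inr i'))).orderTop :=
      hgt (Sum.inr i') ((hge (Sum.inl j₂)).trans_lt (hj₂ i'))
    by_contra hne
    rw [HahnSeries.orderTop_single hne, WithTop.coe_one] at hlt
    exact lt_irrefl _ hlt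

end Helpers

/-- COLLAPSE: if the block `d` is strictly dominated by `c` on distinct arcs and there is an arc,
a typed straightener for `(c, d)` has `W ≤ k^J × 0` (test the translation `t • C u`, `u ∈ W`,
against clause (1) and domination) and projects to one for `c` with the same rank. -/
theorem stub_collapse {k : Type} [Field k] {ι J J' : Type} [Fintype J] [Fintype J']
    [Nonempty ι]
    (c : ι → J → HahnSeries ℚ k) (d : ι → J' → HahnSeries ℚ k)
    (hdom : ∀ a b, a ≠ b → ∃ j, ∀ i, (c a j - c b j).orderTop < (d a i - d b i).orderTop)
    (r : ℕ)
    (h : ∃ W : Submodule k (J ⊕ J' → k), r ≤ Module.finrank k W ∧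
      ∃ φ : ι → J ⊕ J' → HahnSeries ℚ k,
        (∀ a b, a ≠ b → ∃ j, ∀ i,
          (Sum.elim (c a) (d a) j - Sum.elim (c b) (d b) j).orderTop <
            ((φ a i - φ b i) - (Sum.elim (c a) (d a) i - Sum.elim (c b) (d b) i)).orderTop) ∧
        (∀ a i, 0 < (φ a i).orderTop) ∧
        (∀ a (w : J ⊕ J' → HahnSeries ℚ k), (∀ i, 0 < (w i).orderTop) →
          w ∈ Submodule.span (HahnSeries ℚ k)
            ((fun u : J ⊕ J' → k => fun i => HahnSeries.C (u i)) '' (W : Set (J ⊕ J' → k))) →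
          ∃ b, φ b = φ a + w)) :
    ∃ W : Submodule k (J → k), r ≤ Module.finrank k W ∧
      ∃ φ : ι → J → HahnSeries ℚ k,
        (∀ a b, a ≠ b → ∃ j, ∀ i,
          (c a j - c b j).orderTop < ((φ a i - φ b i) - (c a i - c b i)).orderTop) ∧
        (∀ a i, 0 < (φ a i).orderTop) ∧
        (∀ a (w : J → HahnSeries ℚ k), (∀ i, 0 < (w i).orderTop) →
          w ∈ Submodule.span (HahnSeries ℚ k)
            ((fun u : J → k => fun i => HahnSeries.C (u i)) '' (W : Set (J → k))) →
          ∃ b, φ b = φ a + w) := by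
  obtain ⟨W', hW', φ', h1, h2, h3⟩ := h
  obtain ⟨a₀⟩ := ‹Nonempty ι›
  -- every `u ∈ W'` has zero `J'`-block
  have hkey : ∀ u ∈ W', ∀ i', u (Sum.inr i') = 0 := fun u hu i' =>
    collapse_key hdom h1 h3 a₀ hu i'
  -- the projection onto the `J`-block
  let P : (J ⊕ J' → k) →ₗ[k] (J → k) := LinearMap.funLeft k k Sum.inl
  have hinj : Function.Injective (P.domRestrict W') := by
    rintro ⟨u, hu⟩ ⟨u', hu'⟩ huu'
    refine Subtype.ext (funext fun i => ?_)
    cases i with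
    | inl j => exact congr_fun huu' j
    | inr i' =>
      show u (Sum.inr i') = u' (Sum.inr i')
      rw [hkey u hu i', hkey u' hu' i']
  refine ⟨W'.map P, ?_, fun a j => φ' a (Sum.inl j), ?_, fun a j => h2 a (Sum.inl j), ?_⟩
  · -- same rank
    calc r ≤ Module.finrank k W' := hW'
      _ = Module.finrank k (LinearMap.range (P.domRestrict W')) :=
          (LinearMap.finrank_range_of_inj hinj).symm
      _ = Module.finrank k (W'.map P) := by rw [LinearMap.range_domRestrict]
  · -- clause (1): a dominant index in the `J'`-block is beaten by one in the `J`-block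
    intro a b hab
    obtain ⟨j, hj⟩ := h1 a b hab
    cases j with
    | inl j₀ => exact ⟨j₀, fun i => hj (Sum.inl i)⟩
    | inr j₁ =>
      obtain ⟨j₂, hj₂⟩ := hdom a b hab
      exact ⟨j₂, fun i => (hj₂ j₁).trans (hj (Sum.inl i))⟩
  · -- clause (3): extend the translation by zero
    intro a w hw hmem
    let E : (J → HahnSeries ℚ k) →ₗ[HahnSeries ℚ k] (J ⊕ J' → HahnSeries ℚ k) :=
      { toFun := fun x => Sum.elim x 0
        map_add' := fun x y => by
          funext i
          cases i <;> simp
        map_smul' := fun s x => by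
          funext i
          cases i <;> simp }
    have hpos : ∀ i, 0 < (E w i).orderTop := by
      rintro (j | i')
      · exact hw j
      · show 0 < (0 : HahnSeries ℚ k).orderTop
        rw [HahnSeries.orderTop_zero]
        exact WithTop.top_pos
    have hsub : ⇑E '' ((fun u : J → k => fun i => HahnSeries.C (u i)) '' (W'.map P : Set (J → k))) ⊆
        (fun u : J ⊕ J' → k => fun i => HahnSeries.C (u i)) '' (W' : Set (J ⊕ J' → k)) := by
      rintro _ ⟨_, ⟨x, hx, rfl⟩, rfl⟩
      obtain ⟨u, hu, rfl⟩ := Submodule.mem_map.mp hx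
      refine ⟨u, hu, funext fun i => ?_⟩
      cases i with
      | inl j => rfl
      | inr i' =>
        show HahnSeries.C (u (Sum.inr i')) = 0
        rw [hkey u hu i', map_zero]
    have hmem' := Submodule.span_mono hsub (Submodule.apply_mem_span_image_of_mem_span E hmem)
    obtain ⟨b, hb⟩ := h3 a (E w) hpos hmem'
    refine ⟨b, funext fun j => ?_⟩
    have hbj := congr_fun hb (Sum.inl j)
    rw [Pi.add_apply] at hbj
    exact hbj

end Summit.ResolutionOfSingularities.ResolutionOfSingularities.Theorems
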